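import Summits.BirchSwinnertonDyer.BirchSwinnertonDyer.Theorems.AdditiveBranchIMCGordTwoRankZeroCompanionDoorsPaid
import Summits.BirchSwinnertonDyer.Rank1Residual.Additive.X4RankZeroCoveredLocusManinFree
import Summits.BirchSwinnertonDyer.Rank1Residual.Additive.X4RankZeroKatoBoundTamagawaExact
import Summits.BirchSwinnertonDyer.Rank1Residual.Additive.N10IsogenyTransport
import HarnessLib

/-!
# Crux `GordTwoRankZeroOffCaseOne` (item 19357): the companion / visibility doors for X4 rows of EVERY Kodaira type at `p ≥ 5`
# (additive potentially good with `e ∈ {2,3,4,6}`, or potentially multiplicative) — the place `p` PAID, the UPPER half by Kato on X4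

Cell `bsd-addord`, seat `bsd-addord-k1-c2` (D-0074 row B1), gen 9. HONEST FRAMING: nothing here proves the Birch–Swinnerton-Dyer
conjecture or the crux; THEOREMS ONLY (no definition, no named fact, no `sorry`); pure composition of tree theorems; per pair (a per-pair
record instantiates these shapes); the crux stays OPEN at class level; nothing booked by this file.

## Why

The gen-4/5 companion records (`…CompanionRecord<E>.lean`) serve cell (G-ord, `e = 2`): their UPPER half
(`Addv.missingUpperBoundAt_rankZero_of_semistableTwist_of_surj`) needs a good ordinary `p*`-twist model of `E`. Their LOWER half
`missingLowerBoundAt_rankZero_irr_of_witness₆` (gen 5, `…CompanionDoorsPaid.lean`) needs NOTHING at `p` beyond option (a) — the witness is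
`p`-divisible in `W'(ℚ_p)` (formal group at depth `2`, kernel decider) — and is therefore valid for EVERY reduction type of `E` and of the
partner at `p`. For the X4 ∧ `r_an = 0` residue rows of the OTHER Kodaira types (`IV/IV*`, `III/III*`, `II/II*`, `I_n^*`) the UPPER half at
`p ≥ 5` is additive-p4's `X4RankZero.missingUpperBoundAt_of_facts_of_five_le_maninFree` (Kato 2004 Thm. 14.5 (3) in the Manin-free sharp
reading A161′ on the potentially good branch with the Tamagawa certificate `p ∤ ∏ c_ℓ`; Delbourgo + Kato's half-eigen divisibility on the
(M) branch; tower by Serre from surj(p)) — exactly the upper half of gen 8's descent door p535562 `…DescP.bsdp_of_x4_of_selmerGroup_ne_bot_of_five_le_maninFree`,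
whose certificate line `Sel^(p)(E/ℚ) ≠ 0` is here REPLACED by the visibility lower half.

* `bsdp_x4_of_lower_of_five_le_maninFree` — `BSD(E,p)` on an X4 ∧ surj(p) ∧ `r_an = 0` row from ANY lower half `MissingLowerBoundAt W p`
  (`hcov : ord_p j < 0 ∨ p ∤ ∏ c_ℓ`); `isogenous_…` its isogeny-class form (Cassels); `bsdp_x4_potGood_of_lower_katoTam_of_five_le` the
  Tamagawa-exact twin (reading A161″ = A305, NO Tamagawa binder, potentially good rows).
* `bsdp_x4_of_witness₆_of_five_le_maninFree` — the full per-pair shape: the six-option witness data of `missingLowerBoundAt_rankZero_irr_of_witness₆`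
  + the X4 upper half. Named facts `hCT hGZK hU hU2 hF44 hMR` (lower) `+ hKato hDel hmod hmodD hKatoχ` (upper).

References: [MazurRubin2015SelmerCompanions] Thm. 3.1; [CremonaMazur2000] §3 and Table 1; [AgasheStein2002] Lemma 3.6; [Fisher2016Visualizing7]
Thm. 4.4; [SilvermanATAEC1994] V.5.3/5.4, IV.9.2 (d); [Kato2004Asterisque] Thm. 14.5 (3) (p. 236), Thm. 17.4 (3) (p. 273); [Delbourgo1998] Prop. 4;
[Serre1972] IV §3.4; [GreenbergLNM1716] Prop. 4.13; [MilneADT2006] Thm. I.7.3; [Miller2011LMS] Def. 1.1.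
-/

set_option autoImplicit false

noncomputable section

open scoped Classical

open WeierstrassCurve Literature.NumberTheory.EllipticCurves
  Literature.NumberTheory.EllipticCurves.Rank1Residual
  Literature.NumberTheory.EllipticCurves.Rank1Residual.Typed
  Literature.NumberTheory.EllipticCurves.Wuthrich2014
  Literature.NumberTheory.EllipticCurves.Fisher2016
  Literature.NumberTheory.EllipticCurves.MazurRubin2015
  Literature.NumberTheory.EllipticCurves.ModularForms
  Literature.NumberTheory.GaloisRepresentations
  Summit.BirchSwinnertonDyer.Rank1Residual.GaloisImage
  Summit.BirchSwinnertonDyer.Rank1Residual.Supersingular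
open NumberField IsDedekindDomain Rat.HeightOneSpectrum Field

set_option linter.dupNamespace false

namespace Summit.BirchSwinnertonDyer.BirchSwinnertonDyer.Theorems.AdditiveBranchIMCGordTwoRankZeroCompanion

open Summit.BirchSwinnertonDyer.Rank1Residual
open Summit.BirchSwinnertonDyer.Rank1Residual.Additive

section DoorsX4

variable (W : WeierstrassCurve ℚ) [W.IsElliptic] [W.IsGloballyMinimal] (p : ℕ) [hp : Fact p.Prime]

/-- **`BSD(E,p)` on an X4 ∧ surj(p) ∧ `r_an = 0` row at `p ≥ 5` from ANY lower half** `ord_p #Ш_an ≤ ord_p #Ш` (e.g. the visibility lower half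
`missingLowerBoundAt_rankZero_irr_of_witness₆`): upper half = additive-p4's `X4RankZero.missingUpperBoundAt_of_facts_of_five_le_maninFree`
(`hcov : ord_p j < 0 ∨ p ∤ ∏ c_ℓ`; tower by Serre). Binders {hKato = A161′ Manin-free, hDel, hGZK, hmod, hmodD, hKatoχ}. Per pair; nothing booked.
[cite: Kato2004Asterisque, Thm. 14.5 (3) (p. 236), Thm. 17.4 (3) (p. 273)] [cite: Delbourgo1998, Prop. 4 (p. 144)] [cite: Serre1972, IV §3.4]
[cite: SilvermanATAEC1994, Cor. IV.9.2 (d) (PDF p. 340)] [cite: Miller2011LMS, §1 and Def. 1.1] -/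
theorem bsdp_x4_of_lower_of_five_le_maninFree
    (hKato : Kato2004.rankZero_padicValNat_sha_le_sub_localTamagawa_of_additive_potGood_of_imageContainsSL2_maninFree)
    (hDel : Delbourgo1998.prop4_rankZero_pow_dvd_constantCoeff)
    (hGZK : rank_eq_analyticRank_of_analyticRank_le_one) (hmod : hasEntireLFunction_rat)
    (hmodD : nonempty_modularParametrizationData)
    (hKatoχ : Wuthrich2014.kato_halfEigenCharIdeal_dvd_cyclotomicPrime_of_surjective)
    (hp5 : 5 ≤ p) (hr : W.analyticRank = 0) (hX : ClassX4 W p) (hsurj : Surj W p)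
    (hcov : padicValRat p W.j < 0 ∨ ¬ p ∣ W.tamagawaProduct) (hlow : MissingLowerBoundAt W p) : BSDp W p :=
  bsdp_of_missingPPartAt W p hGZK (by rw [hr]; exact zero_le_one)
    (missingPPartAt_of_lower_of_upper W p hlow
      (X4RankZero.missingUpperBoundAt_of_facts_of_five_le_maninFree W p hKato hDel hGZK hmod hmodD hKatoχ hp5 hr hX
        hsurj hcov))

/-- **ISOGENY-CLASS form** of `bsdp_x4_of_lower_of_five_le_maninFree` (Cassels' isogeny invariance `hCassels`; GZK for the rank transport).
[cite: MilneADT2006, Thm. I.7.3 and Remark I.7.4] [cite: Kato2004Asterisque, Thm. 14.5 (3) (p. 236)] [cite: Miller2011LMS, §1 and Def. 1.1] -/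
theorem isogenous_bsdp_x4_of_lower_of_five_le_maninFree
    (hCassels : bsdRHS_eq_of_isIsogenous)
    (hKato : Kato2004.rankZero_padicValNat_sha_le_sub_localTamagawa_of_additive_potGood_of_imageContainsSL2_maninFree)
    (hDel : Delbourgo1998.prop4_rankZero_pow_dvd_constantCoeff)
    (hGZK : rank_eq_analyticRank_of_analyticRank_le_one) (hmod : hasEntireLFunction_rat)
    (hmodD : nonempty_modularParametrizationData)
    (hKatoχ : Wuthrich2014.kato_halfEigenCharIdeal_dvd_cyclotomicPrime_of_surjective)
    {W' : WeierstrassCurve ℚ} [W'.IsElliptic] [W'.IsGloballyMinimal] (hiso : IsIsogenous W' W)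
    (hp5 : 5 ≤ p) (hr : W.analyticRank = 0) (hX : ClassX4 W p) (hsurj : Surj W p)
    (hcov : padicValRat p W.j < 0 ∨ ¬ p ∣ W.tamagawaProduct) (hlow : MissingLowerBoundAt W p) : BSDp W' p := by
  have hr' : W'.analyticRank ≤ 1 := by rw [analyticRank_eq_of_isIsogenous' hiso, hr]; exact zero_le_one
  exact N10.bsdp_of_isIsogenous_of_bsdp p hCassels hGZK hmod hiso hr'
    (bsdp_x4_of_lower_of_five_le_maninFree W p hKato hDel hGZK hmod hmodD hKatoχ hp5 hr hX hsurj hcov hlow)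

/-- **`BSD(E,p)`, `p ≥ 5`, potentially good X4 ∧ surj(p) ∧ `r_an = 0` row from ANY lower half, NO Tamagawa binder**, on the Tamagawa-EXACT
reading hKatoT = A161″ (b2b registry A305; Kato Thm. 14.5 (3) + Prop. 14.16 (2) + §14.8 with Greenberg LNM 1716 Prop. 4.13): n1011's
`X4RankZero.bsdp_of_missingLowerBoundAt_of_katoTam`, tower by Serre. Per pair; nothing booked.
[cite: Kato2004Asterisque, Thm. 14.5 (3) (p. 236), Prop. 14.16 (2) (p. 244), §14.8 (p. 238)] [cite: GreenbergLNM1716, §4 Prop. 4.13]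
[cite: Serre1972, IV §3.4] [cite: Miller2011LMS, §1 and Def. 1.1] -/
theorem bsdp_x4_potGood_of_lower_katoTam_of_five_le
    (hKatoT : Kato2004.rankZero_padicValNat_sha_add_padicValNat_tamagawa_le_of_additive_potGood_of_imageContainsSL2)
    (hGZK : rank_eq_analyticRank_of_analyticRank_le_one) (hmod : hasEntireLFunction_rat)
    (hp5 : 5 ≤ p) (hr : W.analyticRank = 0) (hX : ClassX4 W p) (hpot : 0 ≤ padicValRat p W.j) (hsurj : Surj W p)
    (hlow : MissingLowerBoundAt W p) : BSDp W p :=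
  X4RankZero.bsdp_of_missingLowerBoundAt_of_katoTam W p hKatoT hGZK hmod hr hX hpot
    (towerSurj_of_surj_of_ne_three W p hX hsurj (by omega)) hlow

variable {W p}

/-- **`BSD(E,p)` by VISIBILITY with the place `p` PAID, X4 row of ANY Kodaira type, `p ≥ 5`** — the full per-pair shape: the six-option witness
data of `missingLowerBoundAt_rankZero_irr_of_witness₆` (partner `W'`, `θ : W'[p] ⥲ W[p]`, places `S`, witness `P ∉ pW'(ℚ)`, at every place of
`S` one of (a)/(i)/(ii)/(iii)/(iv)/(v); on these rows the place `p` takes option (a)) + the X4 upper half of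
`bsdp_x4_of_lower_of_five_le_maninFree` (`ClassX4 W p`, `ρ̄` onto, `hcov : ord_p j < 0 ∨ p ∤ ∏ c_ℓ`). Named facts `hCT hGZK hU hU2 hF44 hMR`
(lower half) `+ hKato hDel hmod hmodD hKatoχ` (upper half). Per pair; NOT a class theorem; nothing booked.
[cite: CremonaMazur2000, §3 and Table 1] [cite: MazurRubin2015SelmerCompanions, Thm. 3.1] [cite: Fisher2016Visualizing7, Thm. 4.4 (p. 106)]
[cite: SilvermanATAEC1994, Ch. V Thm. 5.3, Cor. 5.4] [cite: Kato2004Asterisque, Thm. 14.5 (3) (p. 236), Thm. 17.4 (3) (p. 273)]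
[cite: Delbourgo1998, Prop. 4 (p. 144)] [cite: Miller2011LMS, Def. 1.1] -/
theorem bsdp_x4_of_witness₆_of_five_le_maninFree
    (hCT : exists_casselsTate_pairing (K := ℚ)) (hGZK : rank_eq_analyticRank_of_analyticRank_le_one)
    (hU : Silverman1994_thmV53_tateUniformisation.{0})
    (hU2 : Silverman1994_thmV53_corV54_tateUniformisation.{0})
    (hF44 : thm44_selmerLocalKer_iff_of_nonsplit_good) (hMR : selmerLocalKer_iff_of_goodReduction_above)
    (hKato : Kato2004.rankZero_padicValNat_sha_le_sub_localTamagawa_of_additive_potGood_of_imageContainsSL2_maninFree)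
    (hDel : Delbourgo1998.prop4_rankZero_pow_dvd_constantCoeff)
    (hmod : hasEntireLFunction_rat) (hmodD : nonempty_modularParametrizationData)
    (hKatoχ : Wuthrich2014.kato_halfEigenCharIdeal_dvd_cyclotomicPrime_of_surjective)
    (hp5 : 5 ≤ p) (hX : ClassX4 W p) (hsurj : Surj W p) (hr : W.analyticRank = 0)
    (hcov : padicValRat p W.j < 0 ∨ ¬ p ∣ W.tamagawaProduct)
    {q : ℚ} (hq : shaAn W = (q : ℂ)) (hv : padicValRat p q ≤ 2)
    (W' : WeierstrassCurve ℚ) [W'.IsElliptic]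
    (θ : geomTorsion W' (p : ℤ) ≃+ geomTorsion W (p : ℤ))
    (hθ : ∀ (σ : absoluteGaloisGroup ℚ) (P : geomTorsion W' (p : ℤ)), θ (σ • P) = σ • θ P)
    (S : Finset (HeightOneSpectrum (𝓞 ℚ)))
    (hS : ∀ w : HeightOneSpectrum (𝓞 ℚ), w ∉ S →
      W.HasGoodReductionAt w ∧ W'.HasGoodReductionAt w ∧ (p : 𝓞 ℚ) ∉ w.asIdeal)
    (P : W'.toAffine.Point)
    (hP : P ∉ (zsmulAddGroupHom (p : ℤ) : W'.toAffine.Point →+ W'.toAffine.Point).range)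
    (hplaces : ∀ w ∈ S,
      (∃ Q : (W'.baseChange (w.adicCompletion ℚ)).toAffine.Point,
        p • Q = WeierstrassCurve.Affine.Point.baseChange (W' := W') ℚ (w.adicCompletion ℚ) P) ∨
      ((p : 𝓞 ℚ) ∉ w.asIdeal ∧ Nat.card (nsmulAddMonoidHom p :
          (W'.baseChange (w.adicCompletion ℚ)).toAffine.Point →+ _).ker = 1) ∨
      (W.HasSplitMultiplicativeReductionAt w ∧ W'.HasSplitMultiplicativeReductionAt w ∧
        Nat.card (nsmulAddMonoidHom p :
          (W.baseChange (w.adicCompletion ℚ)).toAffine.Point →+ _).ker ≤ p) ∨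
      (W.HasMultiplicativeReductionAt w ∧ W'.HasMultiplicativeReductionAt w ∧
        (∃ r : w.adicCompletion ℚ, algebraMap ℚ (w.adicCompletion ℚ) (-(W.c₄ / W.c₆)) =
          r ^ 2 * algebraMap ℚ (w.adicCompletion ℚ) (-(W'.c₄ / W'.c₆))) ∧
        (∀ ζ : w.adicCompletion ℚ, ζ ^ p = 1 → ζ = 1)) ∨
      ((W.HasMultiplicativeReductionAt w ∧ ¬ W.HasSplitMultiplicativeReductionAt w ∧
          W'.HasGoodReductionAt w) ∨
        (W.HasGoodReductionAt w ∧ W'.HasMultiplicativeReductionAt w ∧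
          ¬ W'.HasSplitMultiplicativeReductionAt w)) ∨
      ((p : 𝓞 ℚ) ∈ w.asIdeal ∧ W.HasGoodReductionAt w ∧ W'.HasGoodReductionAt w)) :
    BSDp W p := by
  have hp2 : p ≠ 2 := by omega
  have hlow : MissingLowerBoundAt W p :=
    missingLowerBoundAt_rankZero_irr_of_witness₆ hCT hGZK hU hU2 hF44 hMR hp2 hX.2.2 hr hq hv W' θ hθ S hS P hP hplaces
  exact bsdp_x4_of_lower_of_five_le_maninFree W p hKato hDel hGZK hmod hmodD hKatoχ hp5 hr hX hsurj hcov hlow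

end DoorsX4

end Summit.BirchSwinnertonDyer.BirchSwinnertonDyer.Theorems.AdditiveBranchIMCGordTwoRankZeroCompanion

end
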